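import Summits.Ventures.Crystal3D.Theorems.StickyWulffConstantGenericWallFloorRayTerraceCapstone
import Summits.Ventures.Crystal3D.Theorems.StickyWulffConstantGenericWallFloorRayTerraceCapstoneThree
import HarnessLib

/-!
# The terrace-steered steep family: the capstones on the HALF-CHORD cap `‖A⁻¹(±e₃) − w₀‖ ≤ ½` (≈ 29°), not only `¼` (≈ 14°)
# (crux `GenericWallFloor`, stmt-Ventures-19480, line `WallLedgerG`; L-2 input, cf-p1 2026-08-28T22:45Z/22:52Z)

HONEST FRAMING. Venture `Summits/Ventures/Crystal3D` (cell `crystal3d-full`), helper `--supports` the crux `GenericWallFloor`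
(stmt-Ventures-19480) of `route-Ventures-StickyWulffConstant`, REGISTERED line `WallLedgerG`, open stub `stub_twoSlabAdhesion`.
Rung credit only; F-C1 not moved; NOT the stub, NOT `c₀ = 1`: ONE-SIDED floors `(√2/2)·(A u)₂`, modulo `ExactOnly`(C12-55) and
`StarPairFar` by name, census-free, standard axioms.

In 19480-p1's capstones (`…RayTerraceCapstone`, `…CapstoneThree`) the cap radius `¼` enters ONLY through the true rise of the launch slot
(`start_slot_inner_ge`: `(A u)₂ ≥ 5/6 − ‖A⁻¹e₃ − w₀‖`), used as the `δ` of 19480-p2's `…OneSidedDirs` ledger; the direction floor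
`hdirs_terrace_up/_down` holds up to `½`, and `hfar` (`image_ne_of_terrace_word[_three]`) and the steepness for the terrace steering are
tilt-free.  So the same proofs run on the half-chord cap with `δ = 5/6 − ½ = 1/3`:
* `genericWallFloorAtCharge_terrace_up_half` / `_down_half` (two-letter word through the terrace — the `Σ9` cap),
* `genericWallFloorAtCharge_terrace_up_three_half` / `_down_three_half` (three-letter words — the `Σ27`-through-terrace caps):
`GenericWallFloorAtCharge ((√2/2)·(A u)₂)` for every pair on the cap `‖A⁻¹(±e₃) − w₀‖ ≤ ½`, every relative translation.  The CHARGE is the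
true flux `(√2/2)·(A u)₂ = (√2/2)·cos∠(A⁻¹e₃, u)`: `0.589` at the cap centre, `0.459` at `16°`, `0.35` at `29°` — so the whole residual cap of
TILT-COVERAGE-g7 (`≤ 16°`) is now covered census-free at charge `≥ 0.458` (the L-2 table's `c_res`).
WHAT THIS IS NOT: not `c₀ = 1`; deeper chain caps need their own `hfar` words; F-C1 not moved.
-/

noncomputable section

namespace Summit.Ventures.Crystal3D.Theorems

open Summit.Ventures.Crystal3D Finset Matrix
open Literature.MathematicalPhysics.StatisticalMechanics (fccStacking)
open scoped InnerProductSpace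

/-- (half-chord cap `‖A⁻¹(±e₃) − w₀‖ ≤ ½`) **Census-free one-sided floor on the `Σ9` cap, grain 1 walking UP** (see the module docstring). -/
theorem genericWallFloorAtCharge_terrace_up_half
    {s₀ : EuclideanSpace ℝ (Fin 3)} (hs₀ : s₀ ∈ fccSlots)
    (hcert : ExactOnly 0 (fccSlots.filter fun w => 0 < ⟪w, s₀⟫_ℝ)) (hSP : StarPairFar)
    (A₁ : EuclideanSpace ℝ (Fin 3) ≃ₗᵢ[ℝ] EuclideanSpace ℝ (Fin 3)) (t₁ : EuclideanSpace ℝ (Fin 3))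
    (A₂ : EuclideanSpace ℝ (Fin 3) ≃ₗᵢ[ℝ] EuclideanSpace ℝ (Fin 3)) (t₂ : EuclideanSpace ℝ (Fin 3))
    {zs w₀ : EuclideanSpace ℝ (Fin 3)} (hzs1 : ‖zs‖ = 1)
    (hzsc : cubicCoords zs = (Real.sqrt 3269)⁻¹ • (![(34 : ℝ), 32, 33] : Fin 3 → ℝ))
    (hw₀ : cubicCoords w₀ = (3 * Real.sqrt 2)⁻¹ • (![(1 : ℝ), 1, 4] : Fin 3 → ℝ))
    (hnear : ‖A₁.symm (EuclideanSpace.single (2 : Fin 3) (1 : ℝ)) - w₀‖ ≤ 1 / 2)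
    (κ₀ κ₁ : EuclideanSpace ℝ (Fin 3))
    (hκl : ∀ μ ∈ [κ₀, κ₁], ‖μ‖ = 1 ∧
      ∀ w ∈ fccSlots, ⟪w, μ⟫_ℝ = 0 ∨ ⟪w, μ⟫_ℝ = Real.sqrt (2 / 3) ∨ ⟪w, μ⟫_ℝ = -Real.sqrt (2 / 3))
    (hκc : List.IsChain (fun μ μ' => ⟪μ, μ'⟫_ℝ = 1 / 3 ∨ ⟪μ, μ'⟫_ℝ = -1 / 3) [κ₀, κ₁])
    (hκ₁ : cubicCoords κ₁ = (Real.sqrt 3)⁻¹ • (![(1 : ℝ), 1, 1] : Fin 3 → ℝ) ∨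
      cubicCoords κ₁ = -((Real.sqrt 3)⁻¹ • (![(1 : ℝ), 1, 1] : Fin 3 → ℝ)))
    (hκ₀ : cubicCoords κ₀ ≠ (Real.sqrt 3)⁻¹ • (![(1 : ℝ), -1, -1] : Fin 3 → ℝ) ∧
      cubicCoords κ₀ ≠ -((Real.sqrt 3)⁻¹ • (![(1 : ℝ), -1, -1] : Fin 3 → ℝ)))
    (hB : A₂ '' fccStacking 1 (Real.sqrt (2 / 3)) = (wordFrame A₁ [κ₀, κ₁]) '' fccStacking 1 (Real.sqrt (2 / 3))) :
    GenericWallFloorAtCharge (Real.sqrt 2 * (A₁ (slotSite 8)) 2 / 2) A₁ t₁ A₂ t₂ := by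
  obtain ⟨zs', hzs1', hzsc', ht, hA⟩ := exists_terrace_steering
  have hzz : zs = zs' := cubicCoords_injective (by rw [hzsc, hzsc'])
  subst hzz
  obtain ⟨hZ, hsteep⟩ := hA A₁
  have hz : ‖A₁ zs‖ = 1 := by rw [LinearIsometryEquiv.norm_map, hzs1]
  have he₃ : (A₁ (slotSite 8)) 2 = ⟪A₁ (slotSite 8), EuclideanSpace.single (2 : Fin 3) (1 : ℝ)⟫_ℝ := by
    rw [EuclideanSpace.inner_single_right]; simp
  have hup : (1 / 3 : ℝ) ≤ (A₁ (slotSite 8)) 2 := by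
    rw [he₃]; have := start_slot_inner_ge A₁ hw₀ (EuclideanSpace.single (2 : Fin 3) (1 : ℝ)); linarith
  exact genericWallFloorAtCharge_oneSided_dirs hs₀ hcert hSP A₁ t₁ A₂ t₂ hz (slotSite_mem 8) hsteep (by norm_num) hup
    (image_ne_of_terrace_word A₁ A₂ hZ ht κ₀ κ₁ hκl hκc hκ₁ hκ₀ hB)
    (hdirs_terrace_up A₁ hZ ht hw₀ (by linarith))

/-- (half-chord cap `‖A⁻¹(±e₃) − w₀‖ ≤ ½`) **Census-free one-sided floor on the `Σ9` cap, grain 2 walking DOWN** (mirror statement: inward vertical `−e₃`, the far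
grain `A₁` presented over `A₂` by the two-letter word through `A₂`'s terrace). -/
theorem genericWallFloorAtCharge_terrace_down_half
    {s₀ : EuclideanSpace ℝ (Fin 3)} (hs₀ : s₀ ∈ fccSlots)
    (hcert : ExactOnly 0 (fccSlots.filter fun w => 0 < ⟪w, s₀⟫_ℝ)) (hSP : StarPairFar)
    (A₁ : EuclideanSpace ℝ (Fin 3) ≃ₗᵢ[ℝ] EuclideanSpace ℝ (Fin 3)) (t₁ : EuclideanSpace ℝ (Fin 3))
    (A₂ : EuclideanSpace ℝ (Fin 3) ≃ₗᵢ[ℝ] EuclideanSpace ℝ (Fin 3)) (t₂ : EuclideanSpace ℝ (Fin 3))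
    {zs w₀ : EuclideanSpace ℝ (Fin 3)} (hzs1 : ‖zs‖ = 1)
    (hzsc : cubicCoords zs = (Real.sqrt 3269)⁻¹ • (![(34 : ℝ), 32, 33] : Fin 3 → ℝ))
    (hw₀ : cubicCoords w₀ = (3 * Real.sqrt 2)⁻¹ • (![(1 : ℝ), 1, 4] : Fin 3 → ℝ))
    (hnear : ‖A₂.symm (-EuclideanSpace.single (2 : Fin 3) (1 : ℝ)) - w₀‖ ≤ 1 / 2)
    (κ₀ κ₁ : EuclideanSpace ℝ (Fin 3))
    (hκl : ∀ μ ∈ [κ₀, κ₁], ‖μ‖ = 1 ∧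
      ∀ w ∈ fccSlots, ⟪w, μ⟫_ℝ = 0 ∨ ⟪w, μ⟫_ℝ = Real.sqrt (2 / 3) ∨ ⟪w, μ⟫_ℝ = -Real.sqrt (2 / 3))
    (hκc : List.IsChain (fun μ μ' => ⟪μ, μ'⟫_ℝ = 1 / 3 ∨ ⟪μ, μ'⟫_ℝ = -1 / 3) [κ₀, κ₁])
    (hκ₁ : cubicCoords κ₁ = (Real.sqrt 3)⁻¹ • (![(1 : ℝ), 1, 1] : Fin 3 → ℝ) ∨
      cubicCoords κ₁ = -((Real.sqrt 3)⁻¹ • (![(1 : ℝ), 1, 1] : Fin 3 → ℝ)))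
    (hκ₀ : cubicCoords κ₀ ≠ (Real.sqrt 3)⁻¹ • (![(1 : ℝ), -1, -1] : Fin 3 → ℝ) ∧
      cubicCoords κ₀ ≠ -((Real.sqrt 3)⁻¹ • (![(1 : ℝ), -1, -1] : Fin 3 → ℝ)))
    (hB : A₁ '' fccStacking 1 (Real.sqrt (2 / 3)) = (wordFrame A₂ [κ₀, κ₁]) '' fccStacking 1 (Real.sqrt (2 / 3))) :
    GenericWallFloorAtCharge (Real.sqrt 2 * (-(A₂ (slotSite 8)) 2) / 2) A₁ t₁ A₂ t₂ := by
  obtain ⟨zs', hzs1', hzsc', ht, hA⟩ := exists_terrace_steering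
  have hzz : zs = zs' := cubicCoords_injective (by rw [hzsc, hzsc'])
  subst hzz
  obtain ⟨hZ, hsteep⟩ := hA A₂
  have hz : ‖A₂ zs‖ = 1 := by rw [LinearIsometryEquiv.norm_map, hzs1]
  have he₃ : -(A₂ (slotSite 8)) 2 = ⟪A₂ (slotSite 8), -EuclideanSpace.single (2 : Fin 3) (1 : ℝ)⟫_ℝ := by
    rw [inner_neg_right, EuclideanSpace.inner_single_right]; simp
  have hdown : (1 / 3 : ℝ) ≤ -(A₂ (slotSite 8)) 2 := by
    rw [he₃]; have := start_slot_inner_ge A₂ hw₀ (-EuclideanSpace.single (2 : Fin 3) (1 : ℝ)); linarith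
  exact genericWallFloorAtCharge_oneSidedDown_dirs hs₀ hcert hSP A₁ t₁ A₂ t₂ hz (slotSite_mem 8) hsteep (by norm_num) hdown
    (image_ne_of_terrace_word A₂ A₁ hZ ht κ₀ κ₁ hκl hκc hκ₁ hκ₀ hB)
    (hdirs_terrace_down A₂ hZ ht hw₀ (by linarith))

/-- (half-chord cap `‖A⁻¹(±e₃) − w₀‖ ≤ ½`) **Census-free one-sided floor on the `Σ27`-type caps through the terrace, grain 1 walking UP.**  See the module docstring. -/
theorem genericWallFloorAtCharge_terrace_up_three_half
    {s₀ : EuclideanSpace ℝ (Fin 3)} (hs₀ : s₀ ∈ fccSlots)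
    (hcert : ExactOnly 0 (fccSlots.filter fun w => 0 < ⟪w, s₀⟫_ℝ)) (hSP : StarPairFar)
    (A₁ : EuclideanSpace ℝ (Fin 3) ≃ₗᵢ[ℝ] EuclideanSpace ℝ (Fin 3)) (t₁ : EuclideanSpace ℝ (Fin 3))
    (A₂ : EuclideanSpace ℝ (Fin 3) ≃ₗᵢ[ℝ] EuclideanSpace ℝ (Fin 3)) (t₂ : EuclideanSpace ℝ (Fin 3))
    {zs w₀ : EuclideanSpace ℝ (Fin 3)} (hzs1 : ‖zs‖ = 1)
    (hzsc : cubicCoords zs = (Real.sqrt 3269)⁻¹ • (![(34 : ℝ), 32, 33] : Fin 3 → ℝ))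
    (hw₀ : cubicCoords w₀ = (3 * Real.sqrt 2)⁻¹ • (![(1 : ℝ), 1, 4] : Fin 3 → ℝ))
    (hnear : ‖A₁.symm (EuclideanSpace.single (2 : Fin 3) (1 : ℝ)) - w₀‖ ≤ 1 / 2)
    (κ₀ κ₁ κ₂ : EuclideanSpace ℝ (Fin 3))
    (hκl : ∀ μ ∈ [κ₀, κ₁, κ₂], ‖μ‖ = 1 ∧
      ∀ w ∈ fccSlots, ⟪w, μ⟫_ℝ = 0 ∨ ⟪w, μ⟫_ℝ = Real.sqrt (2 / 3) ∨ ⟪w, μ⟫_ℝ = -Real.sqrt (2 / 3))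
    (hκc : List.IsChain (fun μ μ' => ⟪μ, μ'⟫_ℝ = 1 / 3 ∨ ⟪μ, μ'⟫_ℝ = -1 / 3) [κ₀, κ₁, κ₂])
    (hκ₂ : cubicCoords κ₂ = (Real.sqrt 3)⁻¹ • (![(1 : ℝ), 1, 1] : Fin 3 → ℝ) ∨
      cubicCoords κ₂ = -((Real.sqrt 3)⁻¹ • (![(1 : ℝ), 1, 1] : Fin 3 → ℝ)))
    (hκ₀₁ : ¬ ((cubicCoords κ₁ = (Real.sqrt 3)⁻¹ • (![(1 : ℝ), -1, -1] : Fin 3 → ℝ) ∨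
        cubicCoords κ₁ = -((Real.sqrt 3)⁻¹ • (![(1 : ℝ), -1, -1] : Fin 3 → ℝ))) ∧
      (cubicCoords κ₀ = (Real.sqrt 3)⁻¹ • (![(-1 : ℝ), -1, 1] : Fin 3 → ℝ) ∨
        cubicCoords κ₀ = -((Real.sqrt 3)⁻¹ • (![(-1 : ℝ), -1, 1] : Fin 3 → ℝ)))))
    (hB : A₂ '' fccStacking 1 (Real.sqrt (2 / 3)) = (wordFrame A₁ [κ₀, κ₁, κ₂]) '' fccStacking 1 (Real.sqrt (2 / 3))) :
    GenericWallFloorAtCharge (Real.sqrt 2 * (A₁ (slotSite 8)) 2 / 2) A₁ t₁ A₂ t₂ := by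
  obtain ⟨zs', hzs1', hzsc', ht, hA⟩ := exists_terrace_steering
  have hzz : zs = zs' := cubicCoords_injective (by rw [hzsc, hzsc'])
  subst hzz
  obtain ⟨hZ, hsteep⟩ := hA A₁
  have hz : ‖A₁ zs‖ = 1 := by rw [LinearIsometryEquiv.norm_map, hzs1]
  have he₃ : (A₁ (slotSite 8)) 2 = ⟪A₁ (slotSite 8), EuclideanSpace.single (2 : Fin 3) (1 : ℝ)⟫_ℝ := by
    rw [EuclideanSpace.inner_single_right]; simp
  have hup : (1 / 3 : ℝ) ≤ (A₁ (slotSite 8)) 2 := by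
    rw [he₃]; have := start_slot_inner_ge A₁ hw₀ (EuclideanSpace.single (2 : Fin 3) (1 : ℝ)); linarith
  exact genericWallFloorAtCharge_oneSided_dirs hs₀ hcert hSP A₁ t₁ A₂ t₂ hz (slotSite_mem 8) hsteep (by norm_num) hup
    (image_ne_of_terrace_word_three A₁ A₂ hZ ht κ₀ κ₁ κ₂ hκl hκc hκ₂ hκ₀₁ hB)
    (hdirs_terrace_up A₁ hZ ht hw₀ (by linarith))

/-- (half-chord cap `‖A⁻¹(±e₃) − w₀‖ ≤ ½`) **Census-free one-sided floor on the `Σ27`-type caps through the terrace, grain 2 walking DOWN** (mirror statement: inward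
vertical `−e₃`, the far grain `A₁` presented over `A₂` by the three-letter word through `A₂`'s terrace). -/
theorem genericWallFloorAtCharge_terrace_down_three_half
    {s₀ : EuclideanSpace ℝ (Fin 3)} (hs₀ : s₀ ∈ fccSlots)
    (hcert : ExactOnly 0 (fccSlots.filter fun w => 0 < ⟪w, s₀⟫_ℝ)) (hSP : StarPairFar)
    (A₁ : EuclideanSpace ℝ (Fin 3) ≃ₗᵢ[ℝ] EuclideanSpace ℝ (Fin 3)) (t₁ : EuclideanSpace ℝ (Fin 3))
    (A₂ : EuclideanSpace ℝ (Fin 3) ≃ₗᵢ[ℝ] EuclideanSpace ℝ (Fin 3)) (t₂ : EuclideanSpace ℝ (Fin 3))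
    {zs w₀ : EuclideanSpace ℝ (Fin 3)} (hzs1 : ‖zs‖ = 1)
    (hzsc : cubicCoords zs = (Real.sqrt 3269)⁻¹ • (![(34 : ℝ), 32, 33] : Fin 3 → ℝ))
    (hw₀ : cubicCoords w₀ = (3 * Real.sqrt 2)⁻¹ • (![(1 : ℝ), 1, 4] : Fin 3 → ℝ))
    (hnear : ‖A₂.symm (-EuclideanSpace.single (2 : Fin 3) (1 : ℝ)) - w₀‖ ≤ 1 / 2)
    (κ₀ κ₁ κ₂ : EuclideanSpace ℝ (Fin 3))
    (hκl : ∀ μ ∈ [κ₀, κ₁, κ₂], ‖μ‖ = 1 ∧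
      ∀ w ∈ fccSlots, ⟪w, μ⟫_ℝ = 0 ∨ ⟪w, μ⟫_ℝ = Real.sqrt (2 / 3) ∨ ⟪w, μ⟫_ℝ = -Real.sqrt (2 / 3))
    (hκc : List.IsChain (fun μ μ' => ⟪μ, μ'⟫_ℝ = 1 / 3 ∨ ⟪μ, μ'⟫_ℝ = -1 / 3) [κ₀, κ₁, κ₂])
    (hκ₂ : cubicCoords κ₂ = (Real.sqrt 3)⁻¹ • (![(1 : ℝ), 1, 1] : Fin 3 → ℝ) ∨
      cubicCoords κ₂ = -((Real.sqrt 3)⁻¹ • (![(1 : ℝ), 1, 1] : Fin 3 → ℝ)))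
    (hκ₀₁ : ¬ ((cubicCoords κ₁ = (Real.sqrt 3)⁻¹ • (![(1 : ℝ), -1, -1] : Fin 3 → ℝ) ∨
        cubicCoords κ₁ = -((Real.sqrt 3)⁻¹ • (![(1 : ℝ), -1, -1] : Fin 3 → ℝ))) ∧
      (cubicCoords κ₀ = (Real.sqrt 3)⁻¹ • (![(-1 : ℝ), -1, 1] : Fin 3 → ℝ) ∨
        cubicCoords κ₀ = -((Real.sqrt 3)⁻¹ • (![(-1 : ℝ), -1, 1] : Fin 3 → ℝ)))))
    (hB : A₁ '' fccStacking 1 (Real.sqrt (2 / 3)) = (wordFrame A₂ [κ₀, κ₁, κ₂]) '' fccStacking 1 (Real.sqrt (2 / 3))) :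
    GenericWallFloorAtCharge (Real.sqrt 2 * (-(A₂ (slotSite 8)) 2) / 2) A₁ t₁ A₂ t₂ := by
  obtain ⟨zs', hzs1', hzsc', ht, hA⟩ := exists_terrace_steering
  have hzz : zs = zs' := cubicCoords_injective (by rw [hzsc, hzsc'])
  subst hzz
  obtain ⟨hZ, hsteep⟩ := hA A₂
  have hz : ‖A₂ zs‖ = 1 := by rw [LinearIsometryEquiv.norm_map, hzs1]
  have he₃ : -(A₂ (slotSite 8)) 2 = ⟪A₂ (slotSite 8), -EuclideanSpace.single (2 : Fin 3) (1 : ℝ)⟫_ℝ := by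
    rw [inner_neg_right, EuclideanSpace.inner_single_right]; simp
  have hdown : (1 / 3 : ℝ) ≤ -(A₂ (slotSite 8)) 2 := by
    rw [he₃]; have := start_slot_inner_ge A₂ hw₀ (-EuclideanSpace.single (2 : Fin 3) (1 : ℝ)); linarith
  exact genericWallFloorAtCharge_oneSidedDown_dirs hs₀ hcert hSP A₁ t₁ A₂ t₂ hz (slotSite_mem 8) hsteep (by norm_num) hdown
    (image_ne_of_terrace_word_three A₂ A₁ hZ ht κ₀ κ₁ κ₂ hκl hκc hκ₂ hκ₀₁ hB)
    (hdirs_terrace_down A₂ hZ ht hw₀ (by linarith))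

end Summit.Ventures.Crystal3D.Theorems

end
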